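import Mathlib.LinearAlgebra.Eigenspace.Zero
import Mathlib.LinearAlgebra.Eigenspace.Charpoly
import Mathlib.RingTheory.Polynomial.Basic
import HarnessLib

/-!
# The canonical finite–singular comparison map is an isomorphism, I: the field case
# (`Q(f) = χ_f/(X − 1)` evaluated at `f` maps ONTO the line `ker (f − 1)`)
# (cell `b2b-bsdres`, team n1011, seat p11 gen 4, OWNERS row T-HCC-adm; file 1/5)

HONEST FRAMING (cell `b2b-bsdres`, run/shared/lean/b2b/bsd-rank1-residual/, verbatim in every
file): the goal of the cell is to DELETE the COMBINATION-SHAPED residual classes of the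
Birch–Swinnerton-Dyer formula for ALL analytic-rank `≤ 1` elliptic curves over `ℚ` — "full BSD
formula for every rank `≤ 1` curve in class `C`" assembled STRICTLY from published theorems — so
that the rank-`≤ 1` remainder becomes exactly the CONSTRUCTION-SHAPED classes, which are TYPED
(missing-input `Prop`s), NOT attempted. This is not "finishing BSD". Team n1011 (N10 / N11, the
additive block X4 ∧ `p = 3`): research route on the CONSTRUCTION-SHAPED class X4; no claim beyond the
stated classes; nothing is booked. TOOL theorems of linear algebra; no definition, no named fact,
no `sorry`.

## What is proved (pure linear algebra over a field `K`)

Mazur–Rubin, *Kolyvagin systems* (Mem. AMS 799, 2004), Lemma 1.2.3, asserts that for a free module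
`T` of finite rank over an artinian ring `R` with `T/(Fr − 1)T` free of rank one, the map
`Q(Fr⁻¹) : T/(Fr − 1)T → T^{Fr=1}` of Def. 1.2.2 (`(x − 1)Q(x) = P(x) = det(1 − Fr·x | T)`) is an
isomorphism; the printed proof reads "When `R` is a field this is Corollary A.2.6 of [Ru6].
Applying that case to the `R/m`-module `T/mT` and using Nakayama's Lemma we see that `Q(Fr⁻¹)` is
surjective.  The exact sequence `0 → T^{Fr=1} → T → T → T/(Fr − 1)T → 0` shows that `T/(Fr − 1)T`
and `T^{Fr=1}` have the same length, so `Q(Fr⁻¹)` is an isomorphism."  This file is the FIELD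
case, in the form used downstream (file 2 turns Rubin's `P` into a unit multiple of the
characteristic polynomial of `Fr⁻¹`):

* `FSComp.finrank_ker_pow_le` — for an endomorphism `f` of a finite-dimensional space,
  `dim ker f^j ≤ j · dim ker f`;
* `FSComp.range_aeval_divByMonic_charpoly_eq_ker` — if `dim ker (f − 1) = 1` then
  **`range (Q₁(f)) = ker (f − 1)`** for `Q₁ = χ_f /ₘ (X − 1)`, `χ_f` the characteristic polynomial.
  Proof: `χ_f = (X − 1)^e · g` with `g(1) ≠ 0`, `e ≥ 1` the multiplicity, so `Q₁ = (X − 1)^{e−1} g`;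
  if `Q₁(f)` vanished, the coprime decompositions `V = ker (f−1)^{e−1} ⊕ ker g(f) = ker (f−1)^e ⊕ ker g(f)`
  would force `ker (f−1)^{e−1} = ker (f−1)^e`, hence (kernels of powers stabilise) the generalised
  eigenspace of `1`, of dimension `e` (Mathlib `LinearMap.finrank_maxGenEigenspace_eq`), would lie in
  `ker (f−1)^{e−1}`, of dimension `≤ e − 1`; so `Q₁(f) ≠ 0`, its values lie in the line `ker (f − 1)`
  (Cayley–Hamilton) and fill it.

References: B. Mazur, K. Rubin, *Kolyvagin systems*, Mem. AMS 799 (2004), Def. 1.2.2, Lemma 1.2.3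
(authors' version pp. 10–11); K. Rubin, *Euler systems and Kolyvagin systems*, PCMI 18 (2011),
Def. 1.9.6 and Exercise 1.9.7 (pp. 14–15); K. Rubin, *Euler Systems*, Ann. of Math. Stud. 147,
Cor. A.2.6 (cited through [MR04]).
-/

namespace Summit.BirchSwinnertonDyer.Rank1Residual.GaloisImage.FSComp

open Polynomial Module

variable {K : Type*} [Field K] {V : Type*} [AddCommGroup V] [Module K V] [FiniteDimensional K V]

/-- `dim ker f^{j+1} ≤ dim ker f^j + dim ker f`: `f` maps `ker f^{j+1}` into `ker f^j` with kernel
inside `ker f`. [folklore] -/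
theorem finrank_ker_pow_succ_le (f : Module.End K V) (j : ℕ) :
    finrank K (LinearMap.ker (f ^ (j + 1))) ≤
      finrank K (LinearMap.ker (f ^ j)) + finrank K (LinearMap.ker f) := by
  let g : LinearMap.ker (f ^ (j + 1)) →ₗ[K] LinearMap.ker (f ^ j) :=
    (f.comp (LinearMap.ker (f ^ (j + 1))).subtype).codRestrict _ (fun x => by
      have hx : (f ^ (j + 1)) (x : V) = 0 := x.2
      rw [LinearMap.mem_ker, LinearMap.comp_apply, Submodule.subtype_apply, ← Module.End.mul_apply,
        ← pow_succ]
      exact hx)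
  have h1 := LinearMap.finrank_range_add_finrank_ker g
  have h2 : finrank K (LinearMap.range g) ≤ finrank K (LinearMap.ker (f ^ j)) :=
    Submodule.finrank_le _
  let i : LinearMap.ker g →ₗ[K] LinearMap.ker f :=
    ((LinearMap.ker (f ^ (j + 1))).subtype.comp (LinearMap.ker g).subtype).codRestrict _ (fun x => by
      have hx : g x.1 = 0 := x.2
      have hx' : (g x.1 : V) = 0 := by rw [hx]; rfl
      rw [LinearMap.mem_ker]
      exact hx')
  have hinj : Function.Injective i := by
    intro x y hxy
    have h := congrArg Subtype.val hxy
    exact Subtype.ext (Subtype.ext h)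
  have h3 : finrank K (LinearMap.ker g) ≤ finrank K (LinearMap.ker f) :=
    LinearMap.finrank_le_finrank_of_injective hinj
  omega

/-- **`dim ker f^j ≤ j · dim ker f`** for an endomorphism of a finite-dimensional space. [folklore] -/
theorem finrank_ker_pow_le (f : Module.End K V) (j : ℕ) :
    finrank K (LinearMap.ker (f ^ j)) ≤ j * finrank K (LinearMap.ker f) := by
  induction j with
  | zero =>
    rw [pow_zero, Module.End.one_eq_id, LinearMap.ker_id, finrank_bot, zero_mul]
  | succ j ih =>
    have h := finrank_ker_pow_succ_le f j
    rw [Nat.succ_mul]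
    omega

omit [FiniteDimensional K V] in
/-- `aeval f ((X − C 1)^k) = (f − 1)^k`. [folklore] -/
theorem aeval_X_sub_C_one_pow (f : Module.End K V) (k : ℕ) :
    aeval f ((X - C (1 : K)) ^ k) = (f - 1) ^ k := by
  rw [map_pow, map_sub, aeval_X, aeval_C, map_one]

/-- For disjoint submodules spanning the whole space, the dimensions add up. [folklore] -/
theorem finrank_add_eq_of_disjoint_of_sup_eq_top {s t : Submodule K V} (hd : Disjoint s t)
    (hst : s ⊔ t = ⊤) : finrank K s + finrank K t = finrank K V := by
  have h := Submodule.finrank_sup_add_finrank_inf_eq s t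
  rw [hst, hd.eq_bot, finrank_bot, finrank_top, add_zero] at h
  exact h.symm

/-- **The field case of [MR04] Lemma 1.2.3 / Rubin PCMI Ex. 1.9.7.**  For an endomorphism `f` of a
finite-dimensional `K`-space with `dim ker (f − 1) = 1`, the operator `Q₁(f)`, `Q₁ = χ_f /ₘ (X − 1)`
(`χ_f` the characteristic polynomial, which vanishes at `1`), has range EXACTLY the line
`ker (f − 1)` — in particular it induces an isomorphism `V/(f − 1)V ⥲ ker (f − 1)` (both are lines).
[cite: MazurRubin2004, Lemma 1.2.3 (p. 10–11)] [cite: Rubin2011, Exercise 1.9.7 (p. 15)] -/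
theorem range_aeval_divByMonic_charpoly_eq_ker (f : Module.End K V)
    (h1 : finrank K (LinearMap.ker (f - 1)) = 1) :
    LinearMap.range (aeval f (f.charpoly /ₘ (X - C 1))) = LinearMap.ker (f - 1) := by
  classical
  set χ := f.charpoly with hχdef
  set N : Module.End K V := f - 1 with hN
  have hχ0 : χ ≠ 0 := (LinearMap.charpoly_monic f).ne_zero
  -- `1` is an eigenvalue, so a root of `χ`
  have hroot : χ.IsRoot 1 := by
    rw [hχdef, ← Module.End.hasEigenvalue_iff_isRoot_charpoly, Module.End.hasEigenvalue_iff,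
      Module.End.eigenspace_def, one_smul]
    intro hbot
    rw [hbot, finrank_bot] at h1
    exact zero_ne_one h1
  set e := χ.rootMultiplicity 1 with he
  have he1 : 1 ≤ e := (Polynomial.rootMultiplicity_pos hχ0).mpr hroot
  obtain ⟨g, hχg, hg⟩ := Polynomial.exists_eq_pow_rootMultiplicity_mul_and_not_dvd χ hχ0 1
  rw [← he] at hχg
  -- `Q₁ = (X - 1)^(e-1) * g`
  have hQ : χ /ₘ (X - C 1) = (X - C 1) ^ (e - 1) * g := by
    have hmonic : (X - C (1 : K)).Monic := monic_X_sub_C 1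
    refine (Polynomial.div_modByMonic_unique ((X - C 1) ^ (e - 1) * g) 0 hmonic ⟨?_, ?_⟩).1
    · rw [zero_add, ← mul_assoc, ← pow_succ', Nat.sub_add_cancel he1]
      exact hχg.symm
    · rw [degree_zero, degree_X_sub_C]
      exact WithBot.bot_lt_coe 1
  -- coprimality of `(X - 1)^k` and `g`
  have hcop : ∀ k : ℕ, IsCoprime ((X - C (1 : K)) ^ k) g := fun k =>
    ((Polynomial.irreducible_X_sub_C (1 : K)).coprime_iff_not_dvd.mpr hg).pow_left
  -- Cayley–Hamilton: the range of `Q₁(f)` lies in `ker (f - 1)`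
  have hle : LinearMap.range (aeval f (χ /ₘ (X - C 1))) ≤ LinearMap.ker N := by
    rintro _ ⟨v, rfl⟩
    rw [LinearMap.mem_ker]
    have hmul : (X - C (1 : K)) * (χ /ₘ (X - C 1)) = χ := mul_divByMonic_eq_iff_isRoot.mpr hroot
    have h := LinearMap.congr_fun (congrArg (aeval f) hmul) v
    rw [map_mul, Module.End.mul_apply, hχdef, LinearMap.aeval_self_charpoly, LinearMap.zero_apply,
      map_sub, aeval_X, aeval_C, map_one] at h
    exact h
  -- `Q₁(f) ≠ 0`
  have hne : ∃ v, aeval f (χ /ₘ (X - C 1)) v ≠ 0 := by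
    by_contra hall
    push Not at hall
    have hker1 : LinearMap.ker (aeval f (χ /ₘ (X - C 1))) = ⊤ :=
      eq_top_iff.mpr fun v _ => LinearMap.mem_ker.mpr (hall v)
    have hkerχ : LinearMap.ker (aeval f χ) = ⊤ := by
      rw [hχdef, LinearMap.aeval_self_charpoly, LinearMap.ker_zero]
    -- the two coprime decompositions
    have hsup1 : LinearMap.ker (N ^ (e - 1)) ⊔ LinearMap.ker (aeval f g) = ⊤ := by
      rw [hN, ← aeval_X_sub_C_one_pow, sup_ker_aeval_eq_ker_aeval_mul_of_coprime f (hcop (e - 1)),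
        ← hQ, hker1]
    have hsup2 : LinearMap.ker (N ^ e) ⊔ LinearMap.ker (aeval f g) = ⊤ := by
      rw [hN, ← aeval_X_sub_C_one_pow, sup_ker_aeval_eq_ker_aeval_mul_of_coprime f (hcop e),
        ← hχg, hkerχ]
    have hdis1 : Disjoint (LinearMap.ker (N ^ (e - 1))) (LinearMap.ker (aeval f g)) := by
      rw [hN, ← aeval_X_sub_C_one_pow]
      exact disjoint_ker_aeval_of_isCoprime f (hcop (e - 1))
    have hdis2 : Disjoint (LinearMap.ker (N ^ e)) (LinearMap.ker (aeval f g)) := by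
      rw [hN, ← aeval_X_sub_C_one_pow]
      exact disjoint_ker_aeval_of_isCoprime f (hcop e)
    have hd1 := finrank_add_eq_of_disjoint_of_sup_eq_top hdis1 hsup1
    have hd2 := finrank_add_eq_of_disjoint_of_sup_eq_top hdis2 hsup2
    have hdeq : finrank K (LinearMap.ker (N ^ (e - 1))) = finrank K (LinearMap.ker (N ^ e)) := by
      omega
    -- hence the kernels coincide and stabilise
    have hkle : LinearMap.ker (N ^ (e - 1)) ≤ LinearMap.ker (N ^ e) := by
      conv_rhs => rw [← Nat.sub_add_cancel he1, pow_succ', Module.End.mul_eq_comp]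
      exact LinearMap.ker_le_ker_comp _ _
    have hkeq : LinearMap.ker (N ^ (e - 1)) = LinearMap.ker (N ^ (e - 1).succ) := by
      rw [Nat.succ_eq_add_one, Nat.sub_add_cancel he1]
      exact Submodule.eq_of_le_of_finrank_eq hkle hdeq
    have hconst := Module.End.ker_pow_constant hkeq
    -- the generalised eigenspace of `1` lies in `ker N^(e-1)`
    have hmax : f.maxGenEigenspace 1 ≤ LinearMap.ker (N ^ (e - 1)) := by
      rw [Module.End.maxGenEigenspace_eq_genEigenspace_finrank, Module.End.genEigenspace_nat,
        one_smul, ← hN]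
      calc LinearMap.ker (N ^ finrank K V)
          ≤ LinearMap.ker (N ^ (e - 1 + finrank K V)) := by
            rw [pow_add, Module.End.mul_eq_comp]
            exact LinearMap.ker_le_ker_comp _ _
        _ = LinearMap.ker (N ^ (e - 1)) := (hconst _).symm
    have hfin := Submodule.finrank_mono hmax
    rw [LinearMap.finrank_maxGenEigenspace_eq, ← hχdef, ← he] at hfin
    have hbound := finrank_ker_pow_le N (e - 1)
    rw [h1, mul_one] at hbound
    omega
  -- conclusion: a non-zero vector of the line `ker (f - 1)` spans it
  obtain ⟨v, hv⟩ := hne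
  refine Submodule.eq_of_le_of_finrank_le hle ?_
  rw [h1]
  by_contra hlt
  push Not at hlt
  have h0 : finrank K (LinearMap.range (aeval f (χ /ₘ (X - C 1)))) = 0 := by omega
  rw [Submodule.finrank_eq_zero] at h0
  exact hv (by
    have hmem : aeval f (χ /ₘ (X - C 1)) v ∈ LinearMap.range (aeval f (χ /ₘ (X - C 1))) :=
      LinearMap.mem_range_self _ v
    rw [h0] at hmem
    exact (Submodule.mem_bot K).mp hmem)

end Summit.BirchSwinnertonDyer.Rank1Residual.GaloisImage.FSComp
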